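import Literature.Barriers.CriticalPhenomena.KozmaNachmiasLemma11Steps
import Literature.Probability.Percolation.CriticalContinuityProofs
import Literature.Probability.LatticeModels.LatticeGraphProofs
import HarnessLib

/-!
# Crux `PercShatteringRace.NearLinearTwoClusterDecay` (stmt-CriticalPhenomena-5785) — frontier stub V2 `stub_vdbdAxisPaths`

Helper file of the line `pair-decay-long-arms-dense` (lead c13); lands with `--supports stmt-CriticalPhenomena-5785`
(registered stub `stub_vdbdAxisPaths` of skeleton rev L14-c13, § Point-to-point frontier: van den Berg–Don 2020 for
bond `ℤ³` at `p_c`).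

## Statement

Call `v ∈ Λ_n = box 3 n` GOOD if `P_{p_c}(0 ↔ v in Λ_n) ≥ 1/(6|Λ_n|)` (van den Berg–Don's Definition 7 with the
Duminil-Copin–Tassion constant `2d = 6`).  `stub_vdbdAxisPaths`: IF for every `n` there is a lattice path
`f(0) = 0, …, f(k) ∈ ∂ⁱⁿΛ_n` of good points of `Λ_n` (stub V1, Lemma 8(b) of the paper), THEN for every `n` and
every axis `i : Fin 3` there is a sequence `g(0), …, g(k)` of good points of `Λ_n` with `ℓ¹`-steps `≤ 1` from the
face `g(0)_i = -n` to the face `g(k)_i = n` (Lemmas 8(a) and 10 of the paper).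

## Proof sketch

* `f(k) ∈ ∂ⁱⁿΛ_n` lies on a face: `|f(k)_{i₀}| = n` for some `i₀` (`exists_eq_of_mem_innerBoundary_box`).
* Coordinatewise absolute values composed with the transposition `π = (i₀ i)`, `g₀(j)_c = |f(j)_{π c}|`, are, point
  by point, signed coordinate permutations of the `f(j)`; these fix `0` and `Λ_n` and preserve `P_{p_c}(0 ↔ · in Λ_n)`
  (`real_openConnIn_signedPerm_box`, Grimmett 1999 §1.6), so every `g₀(j)` is good; `ℓ¹`-steps do not increase
  (`| |a| - |b| | ≤ |a - b|`; lattice neighbours are at `ℓ¹`-distance `1`, `zdGraph_adj_iff_norm_holds`).  Now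
  `g₀(0) = 0` and `g₀(k)_i = n`.
* Reflect and concatenate (Lemma 10): with `ρ_i` the sign change of coordinate `i`, the sequence
  `ρ_i g₀(k), …, ρ_i g₀(0) = 0 = g₀(0), …, g₀(k)` (length `2k`) runs from `x_i = -n` to `x_i = n` through good points
  with `ℓ¹`-steps `≤ 1` (`ρ_i` is an `ℓ¹`-isometry; the junction step has length `0`).

## References

* J. van den Berg, H. Don, *A lower bound for point-to-point connection probabilities in critical percolation*,
  Electron. Commun. Probab. 25 (2020), arXiv:1912.10964, Definition 7, Lemmas 8 and 10 [VandenbergDon2020].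
* G. Grimmett, *Percolation*, 2nd ed., Springer 1999, §1.6 (invariance of `P_p` under lattice symmetries)
  [GrimmettPercolation1999].
-/

noncomputable section

namespace Summit.CriticalPhenomena.PercolationContinuityZ3.Theorems

namespace NearLinearTwoClusterDecayVdbdAxisPaths

open MeasureTheory
open Literature.Probability.LatticeModels Literature.Probability.Percolation

/-! Throughout, `v : Site 3` is a GOOD point of `Λ_n = box 3 n` (van den Berg–Don 2020, Definition 7, bond `ℤ³` at
`p_c`) if `v ∈ box 3 n ∧ 1/(6|Λ_n|) ≤ P_{p_c}(0 ↔ v in Λ_n)` (written out in full below), and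
`ρ_i = Site.signedPerm 1 (Function.update 1 i (-1))` is the reflection in the coordinate `i` (sign change of `x_i`). -/

/-- Signed coordinate permutations preserve goodness: they fix `0` and `Λ_n` and leave `P_{p_c}` invariant
(Grimmett 1999 §1.6, `real_openConnIn_signedPerm_box`). [cite: VandenbergDon2020, Lemma 8(a)] -/
theorem signedPerm_good {n : ℕ} {v : Site 3} (π : Equiv.Perm (Fin 3)) (ε : Fin 3 → ℤˣ)
    (h : v ∈ box 3 n ∧ (1 : ℝ) / (6 * ((box 3 n).card : ℝ)) ≤
      (bondPercolation (zdGraph 3) (criticalProbI 3)).real (openConnIn (↑(box 3 n) : Set (Site 3)) 0 v)) :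
    Site.signedPerm π ε v ∈ box 3 n ∧ (1 : ℝ) / (6 * ((box 3 n).card : ℝ)) ≤
      (bondPercolation (zdGraph 3) (criticalProbI 3)).real
        (openConnIn (↑(box 3 n) : Set (Site 3)) 0 (Site.signedPerm π ε v)) :=
  ⟨(signedPerm_mem_box_iff π ε).2 h.1,
    by rw [Literature.Barriers.CriticalPhenomena.real_openConnIn_signedPerm_box]; exact h.2⟩

/-- Coordinatewise absolute values after a coordinate permutation, `c ↦ |v (π⁻¹ c)|`, is the image of `v` under a
signed coordinate permutation (signs chosen point by point). [folklore] -/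
theorem exists_absPerm_eq_signedPerm (π : Equiv.Perm (Fin 3)) (v : Site 3) :
    ∃ ε : Fin 3 → ℤˣ, (fun c => |v (π.symm c)|) = Site.signedPerm π ε v := by
  refine ⟨fun c => if 0 ≤ v (π.symm c) then 1 else -1, funext fun c => ?_⟩
  simp only [Site.signedPerm_apply]
  split_ifs with h
  · simp [abs_of_nonneg h]
  · simp [abs_of_neg (not_le.1 h)]

/-- Goodness is preserved by `v ↦ (c ↦ |v (π⁻¹ c)|)`. [cite: VandenbergDon2020, Lemma 8(a)] -/
theorem absPerm_good {n : ℕ} {v : Site 3} (π : Equiv.Perm (Fin 3))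
    (h : v ∈ box 3 n ∧ (1 : ℝ) / (6 * ((box 3 n).card : ℝ)) ≤
      (bondPercolation (zdGraph 3) (criticalProbI 3)).real (openConnIn (↑(box 3 n) : Set (Site 3)) 0 v)) :
    (fun c => |v (π.symm c)|) ∈ box 3 n ∧ (1 : ℝ) / (6 * ((box 3 n).card : ℝ)) ≤
      (bondPercolation (zdGraph 3) (criticalProbI 3)).real
        (openConnIn (↑(box 3 n) : Set (Site 3)) 0 (fun c => |v (π.symm c)|)) := by
  obtain ⟨ε, hε⟩ := exists_absPerm_eq_signedPerm π v
  rw [hε]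
  exact signedPerm_good π ε h

/-- `ℓ¹`-steps do not increase under `v ↦ (c ↦ |v (π⁻¹ c)|)`. [folklore] -/
theorem l1_absPerm_le (π : Equiv.Perm (Fin 3)) (x y : Site 3) :
    ∑ c, |(|x (π.symm c)|) - (|y (π.symm c)|)| ≤ ∑ c, |x c - y c| :=
  calc ∑ c, |(|x (π.symm c)|) - (|y (π.symm c)|)| ≤ ∑ c, |x (π.symm c) - y (π.symm c)| :=
        Finset.sum_le_sum fun _ _ => abs_abs_sub_abs_le_abs_sub _ _
    _ = ∑ c, |x c - y c| := Equiv.sum_comp π.symm (fun c => |x c - y c|)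

/-- Lattice neighbours of `ℤ³` are at `ℓ¹`-distance `1`. [folklore] -/
theorem l1_eq_one_of_adj {x y : Site 3} (h : (zdGraph 3).Adj x y) : ∑ c, |x c - y c| = 1 :=
  (zdGraph_adj_iff_norm_holds x y).1 h

/-- `(ρ_i v)_i = -v_i` for the reflection `ρ_i` in the coordinate `i`. [folklore] -/
theorem refl_apply_self (i : Fin 3) (v : Site 3) :
    Site.signedPerm (1 : Equiv.Perm (Fin 3)) (Function.update 1 i (-1)) v i = -v i := by
  have h1 : (Equiv.symm (1 : Equiv.Perm (Fin 3))) i = i := rfl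
  simp [Site.signedPerm_apply, h1]

/-- `(ρ_i v)_c = v_c` for `c ≠ i`, for the reflection `ρ_i` in the coordinate `i`. [folklore] -/
theorem refl_apply_of_ne {i c : Fin 3} (h : c ≠ i) (v : Site 3) :
    Site.signedPerm (1 : Equiv.Perm (Fin 3)) (Function.update 1 i (-1)) v c = v c := by
  have h1 : (Equiv.symm (1 : Equiv.Perm (Fin 3))) c = c := rfl
  simp [Site.signedPerm_apply, h1, Function.update_of_ne h]

/-- The reflection `ρ_i` in the coordinate `i` is an `ℓ¹`-isometry. [folklore] -/
theorem l1_refl (i : Fin 3) (x y : Site 3) :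
    ∑ c, |Site.signedPerm (1 : Equiv.Perm (Fin 3)) (Function.update 1 i (-1)) x c -
        Site.signedPerm (1 : Equiv.Perm (Fin 3)) (Function.update 1 i (-1)) y c| =
      ∑ c, |x c - y c| := by
  refine Finset.sum_congr rfl fun c _ => ?_
  rcases eq_or_ne c i with rfl | h
  · rw [refl_apply_self, refl_apply_self, ← abs_neg]
    congr 1
    ring
  · rw [refl_apply_of_ne h, refl_apply_of_ne h]

/-- **Reflect and concatenate** (van den Berg–Don 2020, Lemma 10): a sequence of good points `g₀(0) = 0, …, g₀(k)`
with `g₀(k)_i = n` and `ℓ¹`-steps `≤ 1` gives the sequence `ρ_i g₀(k), …, ρ_i g₀(0) = g₀(0), …, g₀(k)` of good points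
with `ℓ¹`-steps `≤ 1` from the face `x_i = -n` to the face `x_i = n`. [cite: VandenbergDon2020, Lemma 10] -/
theorem exists_axisPath_of_halfPath {n : ℕ} {i : Fin 3} {k : ℕ} {g₀ : ℕ → Site 3} (h0 : g₀ 0 = 0)
    (hk : g₀ k i = n) (hstep : ∀ j < k, ∑ c, |g₀ j c - g₀ (j + 1) c| ≤ 1)
    (hgood : ∀ j ≤ k, g₀ j ∈ box 3 n ∧ (1 : ℝ) / (6 * ((box 3 n).card : ℝ)) ≤
      (bondPercolation (zdGraph 3) (criticalProbI 3)).real (openConnIn (↑(box 3 n) : Set (Site 3)) 0 (g₀ j))) :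
    ∃ K : ℕ, ∃ g : ℕ → Site 3, g 0 i = -(n : ℤ) ∧ g K i = n ∧
      (∀ j < K, ∑ c, |g j c - g (j + 1) c| ≤ 1) ∧
      ∀ j ≤ K, g j ∈ box 3 n ∧ (1 : ℝ) / (6 * ((box 3 n).card : ℝ)) ≤
        (bondPercolation (zdGraph 3) (criticalProbI 3)).real (openConnIn (↑(box 3 n) : Set (Site 3)) 0 (g j)) := by
  -- the reflected half `ρ_i g₀(k), …, ρ_i g₀(0)` followed by `g₀(0), …, g₀(k)`
  refine ⟨k + k, fun j => if j ≤ k then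
    Site.signedPerm (1 : Equiv.Perm (Fin 3)) (Function.update 1 i (-1)) (g₀ (k - j)) else g₀ (j - k), ?_, ?_, ?_, ?_⟩
  · show (if 0 ≤ k then Site.signedPerm (1 : Equiv.Perm (Fin 3)) (Function.update 1 i (-1)) (g₀ (k - 0))
      else g₀ (0 - k)) i = -(n : ℤ)
    rw [if_pos (Nat.zero_le k), Nat.sub_zero, refl_apply_self, hk]
  · show (if k + k ≤ k then Site.signedPerm (1 : Equiv.Perm (Fin 3)) (Function.update 1 i (-1)) (g₀ (k - (k + k)))
      else g₀ (k + k - k)) i = n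
    rcases Nat.eq_zero_or_pos k with rfl | hpos
    · rw [if_pos le_rfl, Nat.sub_zero, ← hk, h0, Site.signedPerm_zero]
    · have h : ¬ (k + k ≤ k) := by omega
      rw [if_neg h, Nat.add_sub_cancel, hk]
  · intro j hj
    rcases lt_trichotomy (j + 1) (k + 1) with hlt | heq | hgt
    · -- both points on the reflected half
      have h1 : j ≤ k := by omega
      have h2 : j + 1 ≤ k := by omega
      simp only [if_pos h1, if_pos h2, l1_refl]
      have h3 : k - j = k - (j + 1) + 1 := by omega
      rw [h3]
      simpa only [abs_sub_comm] using hstep (k - (j + 1)) (by omega)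
    · -- the junction step at `0`
      have h1 : j = k := by omega
      subst h1
      have h2 : ¬ (j + 1 ≤ j) := by omega
      simp only [le_refl, if_true, Nat.sub_self, if_neg h2, Nat.add_sub_cancel_left, h0, Site.signedPerm_zero]
      simpa only [h0] using hstep 0 (by omega)
    · -- both points on the original half
      have h1 : ¬ (j ≤ k) := by omega
      have h2 : ¬ (j + 1 ≤ k) := by omega
      simp only [if_neg h1, if_neg h2]
      have h3 : j + 1 - k = j - k + 1 := by omega
      rw [h3]
      exact hstep (j - k) (by omega)
  · intro j hj
    by_cases h1 : j ≤ k
    · simp only [if_pos h1]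
      exact signedPerm_good _ _ (hgood (k - j) (by omega))
    · simp only [if_neg h1]
      exact hgood (j - k) (by omega)

/-- **Axis-crossing good sequences from a good path to the boundary** (van den Berg–Don 2020, Lemmas 8(a), 10).
[cite: VandenbergDon2020, Lemma 10] -/
theorem exists_axisPath
    (H : ∀ n : ℕ, ∃ k : ℕ, ∃ f : ℕ → Site 3, f 0 = 0 ∧ f k ∈ innerBoundary (zdGraph 3) (box 3 n) ∧
      (∀ j < k, (zdGraph 3).Adj (f j) (f (j + 1))) ∧
      ∀ j ≤ k, f j ∈ box 3 n ∧
        (1 : ℝ) / (6 * ((box 3 n).card : ℝ)) ≤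
          (bondPercolation (zdGraph 3) (criticalProbI 3)).real (openConnIn (↑(box 3 n) : Set (Site 3)) 0 (f j)))
    (n : ℕ) (i : Fin 3) :
    ∃ k : ℕ, ∃ g : ℕ → Site 3, g 0 i = -(n : ℤ) ∧ g k i = n ∧
      (∀ j < k, ∑ c, |g j c - g (j + 1) c| ≤ 1) ∧
      ∀ j ≤ k, g j ∈ box 3 n ∧
        (1 : ℝ) / (6 * ((box 3 n).card : ℝ)) ≤
          (bondPercolation (zdGraph 3) (criticalProbI 3)).real (openConnIn (↑(box 3 n) : Set (Site 3)) 0 (g j)) := by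
  obtain ⟨k, f, hf0, hfk, hadj, hgood⟩ := H n
  -- the endpoint lies on a face `{x_{i₀} = ± n}`
  obtain ⟨i₀, hi₀⟩ := exists_eq_of_mem_innerBoundary_box hfk
  have habs : |f k i₀| = n := by rcases hi₀ with h | h <;> simp [h]
  -- move `i₀` to the prescribed axis `i` and take coordinatewise absolute values
  set π : Equiv.Perm (Fin 3) := Equiv.swap i₀ i with hπ
  have hπi : π.symm i = i₀ := by rw [hπ, Equiv.symm_swap, Equiv.swap_apply_right]
  refine exists_axisPath_of_halfPath (k := k) (g₀ := fun j c => |f j (π.symm c)|) ?_ ?_ ?_ ?_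
  · funext c
    simp [hf0]
  · show |f k (π.symm i)| = n
    rw [hπi, habs]
  · intro j hj
    show ∑ c, |(|f j (π.symm c)|) - (|f (j + 1) (π.symm c)|)| ≤ 1
    calc ∑ c, |(|f j (π.symm c)|) - (|f (j + 1) (π.symm c)|)| ≤ ∑ c, |f j c - f (j + 1) c| :=
          l1_absPerm_le π _ _
      _ = 1 := l1_eq_one_of_adj (hadj j hj)
  · intro j hj
    exact absPerm_good π (hgood j hj)

end NearLinearTwoClusterDecayVdbdAxisPaths

open MeasureTheory
open Literature.Probability.LatticeModels Literature.Probability.Percolation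
open NearLinearTwoClusterDecayVdbdAxisPaths

/-- **Frontier stub V2 `stub_vdbdAxisPaths` of the line `pair-decay-long-arms-dense`** (registered): van den Berg–Don
2020, Lemmas 8(a) and 10, for bond percolation on `ℤ³` at `p_c`.  From a lattice path of good points of `Λ_n`
(`P_{p_c}(0 ↔ v in Λ_n) ≥ 1/(6|Λ_n|)`) from `0` to `∂ⁱⁿΛ_n` (stub V1), for every axis `i` a sequence of good points of
`Λ_n` with `ℓ¹`-steps `≤ 1` from the face `x_i = -n` to the face `x_i = n`: coordinatewise absolute values, a
transposition of coordinates and the reflection `ρ_i` are signed coordinate permutations, which preserve goodness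
(`real_openConnIn_signedPerm_box`); the reflected path followed by the path itself crosses `Λ_n` along the axis `i`.
[cite: VandenbergDon2020, Lemma 10] -/
theorem stub_vdbdAxisPaths :
    (∀ n : ℕ, ∃ k : ℕ, ∃ f : ℕ → Site 3, f 0 = 0 ∧ f k ∈ innerBoundary (zdGraph 3) (box 3 n) ∧
      (∀ j < k, (zdGraph 3).Adj (f j) (f (j + 1))) ∧
      ∀ j ≤ k, f j ∈ box 3 n ∧
        (1 : ℝ) / (6 * ((box 3 n).card : ℝ)) ≤
          (bondPercolation (zdGraph 3) (criticalProbI 3)).real (openConnIn (↑(box 3 n) : Set (Site 3)) 0 (f j))) →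
    ∀ n : ℕ, ∀ i : Fin 3, ∃ k : ℕ, ∃ g : ℕ → Site 3, g 0 i = -(n : ℤ) ∧ g k i = n ∧
      (∀ j < k, ∑ c, |g j c - g (j + 1) c| ≤ 1) ∧
      ∀ j ≤ k, g j ∈ box 3 n ∧
        (1 : ℝ) / (6 * ((box 3 n).card : ℝ)) ≤
          (bondPercolation (zdGraph 3) (criticalProbI 3)).real (openConnIn (↑(box 3 n) : Set (Site 3)) 0 (g j)) :=
  exists_axisPath

end Summit.CriticalPhenomena.PercolationContinuityZ3.Theorems
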